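/-
Copyright: the b2b-balaban T⁴-continuum CRUX team, row NE7b OWNER lineage `t4-ne7b-p1` (gen 136). Project licence.
-/
import Summits.QuantumFields.BalabanUV.T4Continuum.Spine.NE7b.SupDressedCovarianceDecay

/-!
# THE ROAD'S DRESSED COVARIANCE DECAYS — (β3) INSTANTIATED: the extracted quadratic part `K_D(ψ₀)` of (388) (i) VANISHES off the cells
# (`K_D(x,y) = 0` unless `x, y ∈ ⋃_{p∈C}cell p`), hence has finite range `ρ_Y` for any pseudo-distance in which the polymer's sites are
# `ρ_Y`-close; (ii) has the OPERATOR letter `‖K_Dv‖ ≤ (Λ_w + 4λ_w)‖v‖` from its two matrix letters; so (393) applies: with the NEXT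
# covariance `S ≻ 0`, `S ⪯ γ′·1`, finite range `ρ_S`, and `2λ_wγ′ < 1`,
#   `|(S⁻¹ + K_D)⁻¹(x,y)| ≤ (γ′(Λ_w+4λ_w))^{N+1} · γ′∕(1−2λ_wγ′)`   whenever   `d(x,y) > N(ρ_S+ρ_Y) + ρ_S`
# — the dressed fluctuation covariance of THE ROAD decays exponentially off the diagonal at a rate set by the smallness `γ′(Λ_w+4λ_w)`
# (row NE7b, node U5c; (320)∕(388)∕(393) BY NAME; [folklore])

Cell `pub-balaban`, sub-cell `t4`, spine estimate NE7b (`T4WeightBudget.RelWeightBound`; the cell's OWN estimate — NOT PRINTED in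
[Bałaban 1983–89], NOT PROVED).  Crux-route work under `Spine/NE7b/` by the row OWNER (`t4-ne7b-p1` gen 136, file (395)) under FREEZE
(0)'s crux-prover clause, on this gen's SCOPING-d8 DECISION (2) (the road instance); NOTHING of Bałaban's is named as a Lean object, valued or
asserted; no `T4Continuum/Support` leaf typed; no `def`, no notation (`K_D` WRITTEN OUT); zero `sorry`.  Imports (BY NAME): the OWNER's (393)
`…SupDressedCovarianceDecay` (`dressed_covariance_decay`, `opBound_of_psd_le`) and through it (388) (`nextHessianMatrix_letters`), (320)
(`hessian_neg_log_step_apply`), (387), `FiniteRangeDecomposition`.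

WHAT IS PROVED ([folklore]):
* §1 `opBound_of_two_sided` (`K + k·1 ⪰ 0`, `c·1 − K ⪰ 0`, `0 ≤ k`, `0 ≤ c + k` ⟹ `‖Kv‖ ≤ (c+2k)‖v‖`), `cellSum_single_eq_zero` (sums over the
  cells against a coordinate vector outside the cells vanish);
* §2 **`nextHessian_apply_eq_zero_off`** (`Hess[e_x, k] = 0` and `Hess[h, e_x] = 0` for `x ∉ ⋃cells`, on (320)'s covariance formula),
  **`nextHessianMatrix_eq_zero_off`** (`K_D(x,y) = 0` if `x ∉ ⋃cells` or `y ∉ ⋃cells`), `nextHessianMatrix_hasFiniteRange`,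
  `nextHessianMatrix_opBound` (`‖K_Dv‖ ≤ (Λ_w+4λ_w)‖v‖`);
* §3 THE END **`road_dressed_covariance_decay`**; §4 toy.

HONEST (what this is NOT).  The range `ρ_Y` is the polymer's diameter (K_D is full inside the block — its INTERNAL decay is (333)∕(334), not used
here); the decaying-covariance cluster expansion is NOT typed (β3′); scalar skeleton ((A3), NC-NE7b-α UNRULED); nothing of Bałaban's asserted.
BY-NAME EFFECT ON THE WALL: NONE.  NE7b NOT PRINTED ∕ NOT PROVED; spine PROVED 0∕9; rung (B)+1 — the programme's measures remain FINITE-torus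
statements; NOT the mass gap, NOT Clay.  HONEST DEPENDENCY: continuum YM on T⁴ ⇐ BetaPertH ∧ nine spine estimates (0∕9 proved); BetaPertH ⇐
(D1) ∧ (D4) ∧ CAP+tail; G-an2-4 gates asym, D1 and NE2∕3∕4.
-/

set_option autoImplicit false
set_option maxSynthPendingDepth 2

noncomputable section

namespace Summit.QuantumFields.BalabanUV.T4Continuum.NE7b.SupRoadDressedCovarianceDecay

open MeasureTheory ProbabilityTheory Finset Real Matrix
open scoped BigOperators
open Literature.Analysis.Matrix (HasFiniteRange)
open SupDressedCovarianceDecay (dressed_covariance_decay opBound_of_psd_le)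
open SupNextHessianMatrix (nextHessianMatrix_letters)
open SupEffectiveActionCovariance (hessian_neg_log_step_apply)

variable {ι : Type} [Fintype ι] [DecidableEq ι] {V : Type*}

/-! ## §1. An operator letter from two order letters; sums against a coordinate vector outside the cells -/

/-- **`K + k·1 ⪰ 0`, `c·1 − K ⪰ 0`, `0 ≤ k`, `0 ≤ c + k` ⟹ `‖Kv‖ ≤ (c + 2k)‖v‖`** (via the positive semidefinite `P = K + k·1 ⪯ (c+k)·1`).
[folklore] -/
theorem opBound_of_two_sided {K : Matrix ι ι ℝ} {k c : ℝ} (hKlo : (K + k • (1 : Matrix ι ι ℝ)).PosSemidef)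
    (hKup : (c • (1 : Matrix ι ι ℝ) - K).PosSemidef) (hk : 0 ≤ k) (hck : 0 ≤ c + k) (v : ι → ℝ) :
    ‖(WithLp.toLp 2 (K *ᵥ v) : EuclideanSpace ℝ ι)‖ ≤ (c + 2 * k) * ‖(WithLp.toLp 2 v : EuclideanSpace ℝ ι)‖ := by
  have hP : ((c + k) • (1 : Matrix ι ι ℝ) - (K + k • (1 : Matrix ι ι ℝ))).PosSemidef := by
    have e : (c + k) • (1 : Matrix ι ι ℝ) - (K + k • (1 : Matrix ι ι ℝ)) = c • (1 : Matrix ι ι ℝ) - K := by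
      rw [add_smul]; abel
    rw [e]; exact hKup
  have h1 := opBound_of_psd_le hKlo hP hck v
  have e2 : K *ᵥ v = (K + k • (1 : Matrix ι ι ℝ)) *ᵥ v - k • v := by
    rw [add_mulVec, smul_mulVec, one_mulVec, add_sub_cancel_right]
  rw [e2, WithLp.toLp_sub, WithLp.toLp_smul]
  calc ‖(WithLp.toLp 2 ((K + k • (1 : Matrix ι ι ℝ)) *ᵥ v) : EuclideanSpace ℝ ι) - k • (WithLp.toLp 2 v : EuclideanSpace ℝ ι)‖
      ≤ ‖(WithLp.toLp 2 ((K + k • (1 : Matrix ι ι ℝ)) *ᵥ v) : EuclideanSpace ℝ ι)‖ + ‖k • (WithLp.toLp 2 v : EuclideanSpace ℝ ι)‖ :=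
        norm_sub_le _ _
    _ ≤ (c + k) * ‖(WithLp.toLp 2 v : EuclideanSpace ℝ ι)‖ + k * ‖(WithLp.toLp 2 v : EuclideanSpace ℝ ι)‖ := by
        rw [norm_smul, Real.norm_eq_abs, abs_of_nonneg hk]; exact add_le_add h1 le_rfl
    _ = (c + 2 * k) * ‖(WithLp.toLp 2 v : EuclideanSpace ℝ ι)‖ := by ring

omit [Fintype ι] in
/-- Sums over the cells against the coordinate vector `e_x` of a site `x` OUTSIDE the cells vanish. [folklore] -/
theorem cellSum_single_eq_zero (cell : V → Finset ι) (C : Finset V) {x : ι} (hx : x ∉ C.biUnion cell) (f g : ι → ℝ) :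
    ∑ p ∈ C, ∑ z ∈ cell p, f z * (EuclideanSpace.single x (1 : ℝ) : EuclideanSpace ℝ ι) z * g z = 0 ∧
      ∑ p ∈ C, ∑ z ∈ cell p, f z * (EuclideanSpace.single x (1 : ℝ) : EuclideanSpace ℝ ι) z = 0 := by
  have hz : ∀ p ∈ C, ∀ z ∈ cell p, (EuclideanSpace.single x (1 : ℝ) : EuclideanSpace ℝ ι) z = 0 := fun p hp z hz => by
    have hzx : z ≠ x := fun e => hx (Finset.mem_biUnion.2 ⟨p, hp, e ▸ hz⟩)
    simp [hzx]
  exact ⟨Finset.sum_eq_zero fun p hp => Finset.sum_eq_zero fun z hz' => by rw [hz p hp z hz', mul_zero, zero_mul],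
    Finset.sum_eq_zero fun p hp => Finset.sum_eq_zero fun z hz' => by rw [hz p hp z hz', mul_zero]⟩

/-! ## §2. `K_D` vanishes off the cells; its finite range and operator letter -/

section Road

variable {cell : V → Finset ι} {w w' w'' : ι → ℝ → ℝ} {κ₀ κ₁ κ₂ τ δ θ : ℝ}

/-- **The Hessian applied to a coordinate vector outside the cells vanishes** (both slots), via (320)'s covariance formula. [folklore] -/
theorem nextHessian_apply_eq_zero_off {Γ : Matrix ι ι ℝ} {γop : ℝ} (hΓ : Γ.PosSemidef) (hΓop : (γop • (1 : Matrix ι ι ℝ) - Γ).PosSemidef)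
    (hdisj : ∀ p q, p ≠ q → Disjoint (cell p) (cell q)) (hw' : ∀ x t, HasDerivAt (w x) (w' x t) t) (hw'm : ∀ x, Measurable (w' x))
    (hw''m : ∀ x, Measurable (w'' x)) (hκ₀ : 0 ≤ κ₀) (hκ₁ : 0 ≤ κ₁) (hτ : 0 < τ) (hδ : 0 < δ) (hθ1 : θ < 1)
    (hκθ : (2 * κ₀ * (1 + τ) + 4 * δ) * γop ≤ θ) (hstab : ∀ x, ∀ t : ℝ, -(κ₀ * t ^ 2) ≤ w x t) (hw'b : ∀ x t, |w' x t| ≤ κ₁ * |t|)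
    (hw''b : ∀ x t, |w'' x t| ≤ κ₂) (C : Finset V) (ψ₀ : EuclideanSpace ℝ ι) {x : ι} (hx : x ∉ C.biUnion cell) (k : EuclideanSpace ℝ ι) :
    ((∫ ω : EuclideanSpace ℝ ι, exp (-(∑ p ∈ C, ∑ x ∈ cell p, w x (ω x + ψ₀ x))) ∂(multivariateGaussian 0 Γ))⁻¹ •
          (∫ ω : EuclideanSpace ℝ ι, exp (-(∑ p ∈ C, ∑ x ∈ cell p, w x (ω x + ψ₀ x))) •
            ((∑ p ∈ C, ∑ x ∈ cell p, (w'' x (ω x + ψ₀ x)) • ((EuclideanSpace.proj x : EuclideanSpace ℝ ι →L[ℝ] ℝ).smulRight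
                (EuclideanSpace.proj x : EuclideanSpace ℝ ι →L[ℝ] ℝ))) -
              (∑ p ∈ C, ∑ x ∈ cell p, (w' x (ω x + ψ₀ x)) • (EuclideanSpace.proj x : EuclideanSpace ℝ ι →L[ℝ] ℝ)).smulRight
                (∑ p ∈ C, ∑ x ∈ cell p, (w' x (ω x + ψ₀ x)) • (EuclideanSpace.proj x : EuclideanSpace ℝ ι →L[ℝ] ℝ)))
            ∂(multivariateGaussian 0 Γ)) +
        (((∫ ω : EuclideanSpace ℝ ι, exp (-(∑ p ∈ C, ∑ x ∈ cell p, w x (ω x + ψ₀ x))) ∂(multivariateGaussian 0 Γ)) ^ 2)⁻¹ •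
          ∫ ω : EuclideanSpace ℝ ι, exp (-(∑ p ∈ C, ∑ x ∈ cell p, w x (ω x + ψ₀ x))) •
            (∑ p ∈ C, ∑ x ∈ cell p, (w' x (ω x + ψ₀ x)) • (EuclideanSpace.proj x : EuclideanSpace ℝ ι →L[ℝ] ℝ))
            ∂(multivariateGaussian 0 Γ)).smulRight
          (∫ ω : EuclideanSpace ℝ ι, exp (-(∑ p ∈ C, ∑ x ∈ cell p, w x (ω x + ψ₀ x))) •
            (∑ p ∈ C, ∑ x ∈ cell p, (w' x (ω x + ψ₀ x)) • (EuclideanSpace.proj x : EuclideanSpace ℝ ι →L[ℝ] ℝ))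
            ∂(multivariateGaussian 0 Γ))) (EuclideanSpace.single x (1 : ℝ)) k = 0 ∧
      ((∫ ω : EuclideanSpace ℝ ι, exp (-(∑ p ∈ C, ∑ x ∈ cell p, w x (ω x + ψ₀ x))) ∂(multivariateGaussian 0 Γ))⁻¹ •
          (∫ ω : EuclideanSpace ℝ ι, exp (-(∑ p ∈ C, ∑ x ∈ cell p, w x (ω x + ψ₀ x))) •
            ((∑ p ∈ C, ∑ x ∈ cell p, (w'' x (ω x + ψ₀ x)) • ((EuclideanSpace.proj x : EuclideanSpace ℝ ι →L[ℝ] ℝ).smulRight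
                (EuclideanSpace.proj x : EuclideanSpace ℝ ι →L[ℝ] ℝ))) -
              (∑ p ∈ C, ∑ x ∈ cell p, (w' x (ω x + ψ₀ x)) • (EuclideanSpace.proj x : EuclideanSpace ℝ ι →L[ℝ] ℝ)).smulRight
                (∑ p ∈ C, ∑ x ∈ cell p, (w' x (ω x + ψ₀ x)) • (EuclideanSpace.proj x : EuclideanSpace ℝ ι →L[ℝ] ℝ)))
            ∂(multivariateGaussian 0 Γ)) +
        (((∫ ω : EuclideanSpace ℝ ι, exp (-(∑ p ∈ C, ∑ x ∈ cell p, w x (ω x + ψ₀ x))) ∂(multivariateGaussian 0 Γ)) ^ 2)⁻¹ •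
          ∫ ω : EuclideanSpace ℝ ι, exp (-(∑ p ∈ C, ∑ x ∈ cell p, w x (ω x + ψ₀ x))) •
            (∑ p ∈ C, ∑ x ∈ cell p, (w' x (ω x + ψ₀ x)) • (EuclideanSpace.proj x : EuclideanSpace ℝ ι →L[ℝ] ℝ))
            ∂(multivariateGaussian 0 Γ)).smulRight
          (∫ ω : EuclideanSpace ℝ ι, exp (-(∑ p ∈ C, ∑ x ∈ cell p, w x (ω x + ψ₀ x))) •
            (∑ p ∈ C, ∑ x ∈ cell p, (w' x (ω x + ψ₀ x)) • (EuclideanSpace.proj x : EuclideanSpace ℝ ι →L[ℝ] ℝ))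
            ∂(multivariateGaussian 0 Γ))) k (EuclideanSpace.single x (1 : ℝ)) = 0 := by
  have h1 := hessian_neg_log_step_apply hΓ hΓop hdisj hw' hw'm hw''m hκ₀ hκ₁ hτ hδ hθ1 hκθ hstab hw'b hw''b C ψ₀
    (EuclideanSpace.single x (1 : ℝ)) k
  have h2 := hessian_neg_log_step_apply hΓ hΓop hdisj hw' hw'm hw''m hκ₀ hκ₁ hτ hδ hθ1 hκθ hstab hw'b hw''b C ψ₀
    k (EuclideanSpace.single x (1 : ℝ))
  have hA : ∀ ω : EuclideanSpace ℝ ι,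
      ∑ p ∈ C, ∑ z ∈ cell p, w'' z (ω z + ψ₀ z) * (EuclideanSpace.single x (1 : ℝ) : EuclideanSpace ℝ ι) z * k z = 0 :=
    fun ω => (cellSum_single_eq_zero cell C hx (fun z => w'' z (ω z + ψ₀ z)) (fun z => k z)).1
  have hB : ∀ ω : EuclideanSpace ℝ ι,
      ∑ p ∈ C, ∑ z ∈ cell p, w' z (ω z + ψ₀ z) * (EuclideanSpace.single x (1 : ℝ) : EuclideanSpace ℝ ι) z = 0 :=
    fun ω => (cellSum_single_eq_zero cell C hx (fun z => w' z (ω z + ψ₀ z)) (fun z => k z)).2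
  have hA' : ∀ ω : EuclideanSpace ℝ ι,
      ∑ p ∈ C, ∑ z ∈ cell p, w'' z (ω z + ψ₀ z) * k z * (EuclideanSpace.single x (1 : ℝ) : EuclideanSpace ℝ ι) z = 0 := fun ω => by
    rw [← hA ω]
    exact Finset.sum_congr rfl fun p _ => Finset.sum_congr rfl fun z _ => by ring
  refine ⟨?_, ?_⟩
  · rw [h1]; simp only [hA, hB, zero_mul, sub_zero, mul_zero, integral_zero, zero_mul, mul_zero, add_zero]
  · rw [h2]; simp only [hA', hB, mul_zero, sub_zero, integral_zero, add_zero]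

/-- **`K_D(ψ₀)(x,y) = 0` if `x ∉ ⋃cells` or `y ∉ ⋃cells`.** [folklore] -/
theorem nextHessianMatrix_eq_zero_off {Γ : Matrix ι ι ℝ} {γop : ℝ} (hΓ : Γ.PosSemidef) (hΓop : (γop • (1 : Matrix ι ι ℝ) - Γ).PosSemidef)
    (hdisj : ∀ p q, p ≠ q → Disjoint (cell p) (cell q)) (hw' : ∀ x t, HasDerivAt (w x) (w' x t) t) (hw'm : ∀ x, Measurable (w' x))
    (hw''m : ∀ x, Measurable (w'' x)) (hκ₀ : 0 ≤ κ₀) (hκ₁ : 0 ≤ κ₁) (hτ : 0 < τ) (hδ : 0 < δ) (hθ1 : θ < 1)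
    (hκθ : (2 * κ₀ * (1 + τ) + 4 * δ) * γop ≤ θ) (hstab : ∀ x, ∀ t : ℝ, -(κ₀ * t ^ 2) ≤ w x t) (hw'b : ∀ x t, |w' x t| ≤ κ₁ * |t|)
    (hw''b : ∀ x t, |w'' x t| ≤ κ₂) (C : Finset V) (ψ₀ : EuclideanSpace ℝ ι) {x y : ι} (hxy : x ∉ C.biUnion cell ∨ y ∉ C.biUnion cell) :
    (Matrix.of fun x y : ι =>
      ((((∫ ω : EuclideanSpace ℝ ι, exp (-(∑ p ∈ C, ∑ x ∈ cell p, w x (ω x + ψ₀ x))) ∂(multivariateGaussian 0 Γ))⁻¹ •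
          (∫ ω : EuclideanSpace ℝ ι, exp (-(∑ p ∈ C, ∑ x ∈ cell p, w x (ω x + ψ₀ x))) •
            ((∑ p ∈ C, ∑ x ∈ cell p, (w'' x (ω x + ψ₀ x)) • ((EuclideanSpace.proj x : EuclideanSpace ℝ ι →L[ℝ] ℝ).smulRight
                (EuclideanSpace.proj x : EuclideanSpace ℝ ι →L[ℝ] ℝ))) -
              (∑ p ∈ C, ∑ x ∈ cell p, (w' x (ω x + ψ₀ x)) • (EuclideanSpace.proj x : EuclideanSpace ℝ ι →L[ℝ] ℝ)).smulRight
                (∑ p ∈ C, ∑ x ∈ cell p, (w' x (ω x + ψ₀ x)) • (EuclideanSpace.proj x : EuclideanSpace ℝ ι →L[ℝ] ℝ)))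
            ∂(multivariateGaussian 0 Γ)) +
        (((∫ ω : EuclideanSpace ℝ ι, exp (-(∑ p ∈ C, ∑ x ∈ cell p, w x (ω x + ψ₀ x))) ∂(multivariateGaussian 0 Γ)) ^ 2)⁻¹ •
          ∫ ω : EuclideanSpace ℝ ι, exp (-(∑ p ∈ C, ∑ x ∈ cell p, w x (ω x + ψ₀ x))) •
            (∑ p ∈ C, ∑ x ∈ cell p, (w' x (ω x + ψ₀ x)) • (EuclideanSpace.proj x : EuclideanSpace ℝ ι →L[ℝ] ℝ))
            ∂(multivariateGaussian 0 Γ)).smulRight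
          (∫ ω : EuclideanSpace ℝ ι, exp (-(∑ p ∈ C, ∑ x ∈ cell p, w x (ω x + ψ₀ x))) •
            (∑ p ∈ C, ∑ x ∈ cell p, (w' x (ω x + ψ₀ x)) • (EuclideanSpace.proj x : EuclideanSpace ℝ ι →L[ℝ] ℝ))
            ∂(multivariateGaussian 0 Γ)))
          (EuclideanSpace.single x (1 : ℝ)) (EuclideanSpace.single y (1 : ℝ)) +
        ((∫ ω : EuclideanSpace ℝ ι, exp (-(∑ p ∈ C, ∑ x ∈ cell p, w x (ω x + ψ₀ x))) ∂(multivariateGaussian 0 Γ))⁻¹ •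
          (∫ ω : EuclideanSpace ℝ ι, exp (-(∑ p ∈ C, ∑ x ∈ cell p, w x (ω x + ψ₀ x))) •
            ((∑ p ∈ C, ∑ x ∈ cell p, (w'' x (ω x + ψ₀ x)) • ((EuclideanSpace.proj x : EuclideanSpace ℝ ι →L[ℝ] ℝ).smulRight
                (EuclideanSpace.proj x : EuclideanSpace ℝ ι →L[ℝ] ℝ))) -
              (∑ p ∈ C, ∑ x ∈ cell p, (w' x (ω x + ψ₀ x)) • (EuclideanSpace.proj x : EuclideanSpace ℝ ι →L[ℝ] ℝ)).smulRight
                (∑ p ∈ C, ∑ x ∈ cell p, (w' x (ω x + ψ₀ x)) • (EuclideanSpace.proj x : EuclideanSpace ℝ ι →L[ℝ] ℝ)))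
            ∂(multivariateGaussian 0 Γ)) +
        (((∫ ω : EuclideanSpace ℝ ι, exp (-(∑ p ∈ C, ∑ x ∈ cell p, w x (ω x + ψ₀ x))) ∂(multivariateGaussian 0 Γ)) ^ 2)⁻¹ •
          ∫ ω : EuclideanSpace ℝ ι, exp (-(∑ p ∈ C, ∑ x ∈ cell p, w x (ω x + ψ₀ x))) •
            (∑ p ∈ C, ∑ x ∈ cell p, (w' x (ω x + ψ₀ x)) • (EuclideanSpace.proj x : EuclideanSpace ℝ ι →L[ℝ] ℝ))
            ∂(multivariateGaussian 0 Γ)).smulRight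
          (∫ ω : EuclideanSpace ℝ ι, exp (-(∑ p ∈ C, ∑ x ∈ cell p, w x (ω x + ψ₀ x))) •
            (∑ p ∈ C, ∑ x ∈ cell p, (w' x (ω x + ψ₀ x)) • (EuclideanSpace.proj x : EuclideanSpace ℝ ι →L[ℝ] ℝ))
            ∂(multivariateGaussian 0 Γ)))
          (EuclideanSpace.single y (1 : ℝ)) (EuclideanSpace.single x (1 : ℝ))) / 2)) x y = 0 := by
  rw [Matrix.of_apply]
  rcases hxy with hx | hy
  · obtain ⟨a, -⟩ := nextHessian_apply_eq_zero_off hΓ hΓop hdisj hw' hw'm hw''m hκ₀ hκ₁ hτ hδ hθ1 hκθ hstab hw'b hw''b C ψ₀ hx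
      (EuclideanSpace.single y (1 : ℝ))
    obtain ⟨-, b⟩ := nextHessian_apply_eq_zero_off hΓ hΓop hdisj hw' hw'm hw''m hκ₀ hκ₁ hτ hδ hθ1 hκθ hstab hw'b hw''b C ψ₀ hx
      (EuclideanSpace.single y (1 : ℝ))
    rw [a, b]; norm_num
  · obtain ⟨a, -⟩ := nextHessian_apply_eq_zero_off hΓ hΓop hdisj hw' hw'm hw''m hκ₀ hκ₁ hτ hδ hθ1 hκθ hstab hw'b hw''b C ψ₀ hy
      (EuclideanSpace.single x (1 : ℝ))
    obtain ⟨-, b⟩ := nextHessian_apply_eq_zero_off hΓ hΓop hdisj hw' hw'm hw''m hκ₀ hκ₁ hτ hδ hθ1 hκθ hstab hw'b hw''b C ψ₀ hy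
      (EuclideanSpace.single x (1 : ℝ))
    rw [a, b]; norm_num

/-- **`K_D` has finite range `ρ_Y`** for any pseudo-distance in which the sites of `⋃cells` are pairwise `ρ_Y`-close. [folklore] -/
theorem nextHessianMatrix_hasFiniteRange {Γ : Matrix ι ι ℝ} {γop : ℝ} (hΓ : Γ.PosSemidef)
    (hΓop : (γop • (1 : Matrix ι ι ℝ) - Γ).PosSemidef)
    (hdisj : ∀ p q, p ≠ q → Disjoint (cell p) (cell q)) (hw' : ∀ x t, HasDerivAt (w x) (w' x t) t) (hw'm : ∀ x, Measurable (w' x))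
    (hw''m : ∀ x, Measurable (w'' x)) (hκ₀ : 0 ≤ κ₀) (hκ₁ : 0 ≤ κ₁) (hτ : 0 < τ) (hδ : 0 < δ) (hθ1 : θ < 1)
    (hκθ : (2 * κ₀ * (1 + τ) + 4 * δ) * γop ≤ θ) (hstab : ∀ x, ∀ t : ℝ, -(κ₀ * t ^ 2) ≤ w x t) (hw'b : ∀ x t, |w' x t| ≤ κ₁ * |t|)
    (hw''b : ∀ x t, |w'' x t| ≤ κ₂) (C : Finset V) (ψ₀ : EuclideanSpace ℝ ι) {d : ι → ι → ℕ} {ρY : ℕ}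
    (hY : ∀ x ∈ C.biUnion cell, ∀ y ∈ C.biUnion cell, d x y ≤ ρY) :
    HasFiniteRange d ρY (Matrix.of fun x y : ι =>
      ((((∫ ω : EuclideanSpace ℝ ι, exp (-(∑ p ∈ C, ∑ x ∈ cell p, w x (ω x + ψ₀ x))) ∂(multivariateGaussian 0 Γ))⁻¹ •
          (∫ ω : EuclideanSpace ℝ ι, exp (-(∑ p ∈ C, ∑ x ∈ cell p, w x (ω x + ψ₀ x))) •
            ((∑ p ∈ C, ∑ x ∈ cell p, (w'' x (ω x + ψ₀ x)) • ((EuclideanSpace.proj x : EuclideanSpace ℝ ι →L[ℝ] ℝ).smulRight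
                (EuclideanSpace.proj x : EuclideanSpace ℝ ι →L[ℝ] ℝ))) -
              (∑ p ∈ C, ∑ x ∈ cell p, (w' x (ω x + ψ₀ x)) • (EuclideanSpace.proj x : EuclideanSpace ℝ ι →L[ℝ] ℝ)).smulRight
                (∑ p ∈ C, ∑ x ∈ cell p, (w' x (ω x + ψ₀ x)) • (EuclideanSpace.proj x : EuclideanSpace ℝ ι →L[ℝ] ℝ)))
            ∂(multivariateGaussian 0 Γ)) +
        (((∫ ω : EuclideanSpace ℝ ι, exp (-(∑ p ∈ C, ∑ x ∈ cell p, w x (ω x + ψ₀ x))) ∂(multivariateGaussian 0 Γ)) ^ 2)⁻¹ •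
          ∫ ω : EuclideanSpace ℝ ι, exp (-(∑ p ∈ C, ∑ x ∈ cell p, w x (ω x + ψ₀ x))) •
            (∑ p ∈ C, ∑ x ∈ cell p, (w' x (ω x + ψ₀ x)) • (EuclideanSpace.proj x : EuclideanSpace ℝ ι →L[ℝ] ℝ))
            ∂(multivariateGaussian 0 Γ)).smulRight
          (∫ ω : EuclideanSpace ℝ ι, exp (-(∑ p ∈ C, ∑ x ∈ cell p, w x (ω x + ψ₀ x))) •
            (∑ p ∈ C, ∑ x ∈ cell p, (w' x (ω x + ψ₀ x)) • (EuclideanSpace.proj x : EuclideanSpace ℝ ι →L[ℝ] ℝ))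
            ∂(multivariateGaussian 0 Γ)))
          (EuclideanSpace.single x (1 : ℝ)) (EuclideanSpace.single y (1 : ℝ)) +
        ((∫ ω : EuclideanSpace ℝ ι, exp (-(∑ p ∈ C, ∑ x ∈ cell p, w x (ω x + ψ₀ x))) ∂(multivariateGaussian 0 Γ))⁻¹ •
          (∫ ω : EuclideanSpace ℝ ι, exp (-(∑ p ∈ C, ∑ x ∈ cell p, w x (ω x + ψ₀ x))) •
            ((∑ p ∈ C, ∑ x ∈ cell p, (w'' x (ω x + ψ₀ x)) • ((EuclideanSpace.proj x : EuclideanSpace ℝ ι →L[ℝ] ℝ).smulRight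
                (EuclideanSpace.proj x : EuclideanSpace ℝ ι →L[ℝ] ℝ))) -
              (∑ p ∈ C, ∑ x ∈ cell p, (w' x (ω x + ψ₀ x)) • (EuclideanSpace.proj x : EuclideanSpace ℝ ι →L[ℝ] ℝ)).smulRight
                (∑ p ∈ C, ∑ x ∈ cell p, (w' x (ω x + ψ₀ x)) • (EuclideanSpace.proj x : EuclideanSpace ℝ ι →L[ℝ] ℝ)))
            ∂(multivariateGaussian 0 Γ)) +
        (((∫ ω : EuclideanSpace ℝ ι, exp (-(∑ p ∈ C, ∑ x ∈ cell p, w x (ω x + ψ₀ x))) ∂(multivariateGaussian 0 Γ)) ^ 2)⁻¹ •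
          ∫ ω : EuclideanSpace ℝ ι, exp (-(∑ p ∈ C, ∑ x ∈ cell p, w x (ω x + ψ₀ x))) •
            (∑ p ∈ C, ∑ x ∈ cell p, (w' x (ω x + ψ₀ x)) • (EuclideanSpace.proj x : EuclideanSpace ℝ ι →L[ℝ] ℝ))
            ∂(multivariateGaussian 0 Γ)).smulRight
          (∫ ω : EuclideanSpace ℝ ι, exp (-(∑ p ∈ C, ∑ x ∈ cell p, w x (ω x + ψ₀ x))) •
            (∑ p ∈ C, ∑ x ∈ cell p, (w' x (ω x + ψ₀ x)) • (EuclideanSpace.proj x : EuclideanSpace ℝ ι →L[ℝ] ℝ))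
            ∂(multivariateGaussian 0 Γ)))
          (EuclideanSpace.single y (1 : ℝ)) (EuclideanSpace.single x (1 : ℝ))) / 2)) := by
  intro x y hxy
  refine nextHessianMatrix_eq_zero_off hΓ hΓop hdisj hw' hw'm hw''m hκ₀ hκ₁ hτ hδ hθ1 hκθ hstab hw'b hw''b C ψ₀ ?_
  by_contra h
  rw [not_or, not_not, not_not] at h
  exact absurd (hY x h.1 y h.2) (not_le.2 hxy)

/-- **THE OPERATOR LETTER OF `K_D`**: under (388)'s hypotheses, `‖K_D(ψ₀)v‖ ≤ (Λ_w + 4λ_w)‖v‖`. [folklore] -/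
theorem nextHessianMatrix_opBound {M : Matrix ι ι ℝ} {γop m lamw Λw : ℝ} (hM : M.PosDef)
    (hfl : ∀ z : ι → ℝ, m * ∑ i, z i ^ 2 ≤ z ⬝ᵥ (M *ᵥ z)) (hΓop : (γop • (1 : Matrix ι ι ℝ) - M⁻¹).PosSemidef)
    (hdisj : ∀ p q, p ≠ q → Disjoint (cell p) (cell q)) (hw' : ∀ x t, HasDerivAt (w x) (w' x t) t)
    (hw'' : ∀ x t, HasDerivAt (w' x) (w'' x t) t) (hw'm : ∀ x, Measurable (w' x)) (hw''m : ∀ x, Measurable (w'' x))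
    (hκ₀ : 0 ≤ κ₀) (hκ₁ : 0 ≤ κ₁) (hτ : 0 < τ) (hδ : 0 < δ) (hθ0 : 0 < θ) (hθ1 : θ < 1) (hκθ : (2 * κ₀ * (1 + τ) + 4 * δ) * γop ≤ θ)
    (hκθ₆ : 6 * κ₀ * (1 + τ) * γop ≤ θ) (hstab : ∀ x, ∀ t : ℝ, -(κ₀ * t ^ 2) ≤ w x t) (hquad : ∀ x, ∀ t : ℝ, w x t ≤ κ₀ * t ^ 2)
    (hw'b : ∀ x t, |w' x t| ≤ κ₁ * |t|) (hw''b : ∀ x t, |w'' x t| ≤ κ₂) (hlamw : 0 ≤ lamw) (hΛw : 0 ≤ Λw)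
    (hwlo : ∀ u (a b : ℝ), w u a + w' u a * (b - a) - lamw / 2 * (b - a) ^ 2 ≤ w u b)
    (hwup : ∀ x (a b : ℝ), w x b ≤ w x a + w' x a * (b - a) + Λw / 2 * (b - a) ^ 2) (hm : 2 * lamw ≤ m) (C : Finset V)
    (ψ₀ : EuclideanSpace ℝ ι) (v : ι → ℝ) :
    ‖(WithLp.toLp 2 ((Matrix.of fun x y : ι =>
      ((((∫ ω : EuclideanSpace ℝ ι, exp (-(∑ p ∈ C, ∑ x ∈ cell p, w x (ω x + ψ₀ x))) ∂(multivariateGaussian 0 M⁻¹))⁻¹ •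
          (∫ ω : EuclideanSpace ℝ ι, exp (-(∑ p ∈ C, ∑ x ∈ cell p, w x (ω x + ψ₀ x))) •
            ((∑ p ∈ C, ∑ x ∈ cell p, (w'' x (ω x + ψ₀ x)) • ((EuclideanSpace.proj x : EuclideanSpace ℝ ι →L[ℝ] ℝ).smulRight
                (EuclideanSpace.proj x : EuclideanSpace ℝ ι →L[ℝ] ℝ))) -
              (∑ p ∈ C, ∑ x ∈ cell p, (w' x (ω x + ψ₀ x)) • (EuclideanSpace.proj x : EuclideanSpace ℝ ι →L[ℝ] ℝ)).smulRight
                (∑ p ∈ C, ∑ x ∈ cell p, (w' x (ω x + ψ₀ x)) • (EuclideanSpace.proj x : EuclideanSpace ℝ ι →L[ℝ] ℝ)))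
            ∂(multivariateGaussian 0 M⁻¹)) +
        (((∫ ω : EuclideanSpace ℝ ι, exp (-(∑ p ∈ C, ∑ x ∈ cell p, w x (ω x + ψ₀ x))) ∂(multivariateGaussian 0 M⁻¹)) ^ 2)⁻¹ •
          ∫ ω : EuclideanSpace ℝ ι, exp (-(∑ p ∈ C, ∑ x ∈ cell p, w x (ω x + ψ₀ x))) •
            (∑ p ∈ C, ∑ x ∈ cell p, (w' x (ω x + ψ₀ x)) • (EuclideanSpace.proj x : EuclideanSpace ℝ ι →L[ℝ] ℝ))
            ∂(multivariateGaussian 0 M⁻¹)).smulRight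
          (∫ ω : EuclideanSpace ℝ ι, exp (-(∑ p ∈ C, ∑ x ∈ cell p, w x (ω x + ψ₀ x))) •
            (∑ p ∈ C, ∑ x ∈ cell p, (w' x (ω x + ψ₀ x)) • (EuclideanSpace.proj x : EuclideanSpace ℝ ι →L[ℝ] ℝ))
            ∂(multivariateGaussian 0 M⁻¹)))
          (EuclideanSpace.single x (1 : ℝ)) (EuclideanSpace.single y (1 : ℝ)) +
        ((∫ ω : EuclideanSpace ℝ ι, exp (-(∑ p ∈ C, ∑ x ∈ cell p, w x (ω x + ψ₀ x))) ∂(multivariateGaussian 0 M⁻¹))⁻¹ •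
          (∫ ω : EuclideanSpace ℝ ι, exp (-(∑ p ∈ C, ∑ x ∈ cell p, w x (ω x + ψ₀ x))) •
            ((∑ p ∈ C, ∑ x ∈ cell p, (w'' x (ω x + ψ₀ x)) • ((EuclideanSpace.proj x : EuclideanSpace ℝ ι →L[ℝ] ℝ).smulRight
                (EuclideanSpace.proj x : EuclideanSpace ℝ ι →L[ℝ] ℝ))) -
              (∑ p ∈ C, ∑ x ∈ cell p, (w' x (ω x + ψ₀ x)) • (EuclideanSpace.proj x : EuclideanSpace ℝ ι →L[ℝ] ℝ)).smulRight
                (∑ p ∈ C, ∑ x ∈ cell p, (w' x (ω x + ψ₀ x)) • (EuclideanSpace.proj x : EuclideanSpace ℝ ι →L[ℝ] ℝ)))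
            ∂(multivariateGaussian 0 M⁻¹)) +
        (((∫ ω : EuclideanSpace ℝ ι, exp (-(∑ p ∈ C, ∑ x ∈ cell p, w x (ω x + ψ₀ x))) ∂(multivariateGaussian 0 M⁻¹)) ^ 2)⁻¹ •
          ∫ ω : EuclideanSpace ℝ ι, exp (-(∑ p ∈ C, ∑ x ∈ cell p, w x (ω x + ψ₀ x))) •
            (∑ p ∈ C, ∑ x ∈ cell p, (w' x (ω x + ψ₀ x)) • (EuclideanSpace.proj x : EuclideanSpace ℝ ι →L[ℝ] ℝ))
            ∂(multivariateGaussian 0 M⁻¹)).smulRight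
          (∫ ω : EuclideanSpace ℝ ι, exp (-(∑ p ∈ C, ∑ x ∈ cell p, w x (ω x + ψ₀ x))) •
            (∑ p ∈ C, ∑ x ∈ cell p, (w' x (ω x + ψ₀ x)) • (EuclideanSpace.proj x : EuclideanSpace ℝ ι →L[ℝ] ℝ))
            ∂(multivariateGaussian 0 M⁻¹)))
          (EuclideanSpace.single y (1 : ℝ)) (EuclideanSpace.single x (1 : ℝ))) / 2)) *ᵥ v) : EuclideanSpace ℝ ι)‖ ≤ (Λw + 4 * lamw) * ‖(WithLp.toLp 2 v : EuclideanSpace ℝ ι)‖ := by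
  obtain ⟨-, hlo, hup⟩ := nextHessianMatrix_letters hM hfl hΓop hdisj hw' hw'' hw'm hw''m hκ₀ hκ₁ hτ hδ hθ0 hθ1 hκθ hκθ₆ hstab hquad hw'b hw''b hlamw hΛw hwlo hwup hm C ψ₀
  have h := opBound_of_two_sided hlo hup (by positivity) (by positivity) v
  have e : Λw + 2 * (2 * lamw) = Λw + 4 * lamw := by ring
  rw [e] at h
  exact h

/-! ## §3. THE END: the road's dressed covariance decays -/

/-- **THE ROAD'S DRESSED COVARIANCE DECAYS OFF THE DIAGONAL.**  Under (388)'s hypotheses (this step over `N(0,M⁻¹)`), a pseudo-distance `d`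
(triangle inequality, `d(i,i) = 0`) in which the polymer's sites are `ρ_Y`-close, and a NEXT covariance `S ≻ 0` with `γ′·1 − S ⪰ 0`, `0 < γ′`,
finite range `ρ_S` and `2λ_wγ′ < 1`: for every `N` and all `x, y` with `d(x,y) > N(ρ_S+ρ_Y) + ρ_S`,
`|(S⁻¹ + K_D(ψ₀))⁻¹(x,y)| ≤ (γ′(Λ_w+4λ_w))^{N+1}·γ′∕(1−2λ_wγ′)`. [folklore] -/
theorem road_dressed_covariance_decay {M : Matrix ι ι ℝ} {γop m lamw Λw : ℝ} (hM : M.PosDef)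
    (hfl : ∀ z : ι → ℝ, m * ∑ i, z i ^ 2 ≤ z ⬝ᵥ (M *ᵥ z)) (hΓop : (γop • (1 : Matrix ι ι ℝ) - M⁻¹).PosSemidef)
    (hdisj : ∀ p q, p ≠ q → Disjoint (cell p) (cell q)) (hw' : ∀ x t, HasDerivAt (w x) (w' x t) t)
    (hw'' : ∀ x t, HasDerivAt (w' x) (w'' x t) t) (hw'm : ∀ x, Measurable (w' x)) (hw''m : ∀ x, Measurable (w'' x))
    (hκ₀ : 0 ≤ κ₀) (hκ₁ : 0 ≤ κ₁) (hτ : 0 < τ) (hδ : 0 < δ) (hθ0 : 0 < θ) (hθ1 : θ < 1) (hκθ : (2 * κ₀ * (1 + τ) + 4 * δ) * γop ≤ θ)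
    (hκθ₆ : 6 * κ₀ * (1 + τ) * γop ≤ θ) (hstab : ∀ x, ∀ t : ℝ, -(κ₀ * t ^ 2) ≤ w x t) (hquad : ∀ x, ∀ t : ℝ, w x t ≤ κ₀ * t ^ 2)
    (hw'b : ∀ x t, |w' x t| ≤ κ₁ * |t|) (hw''b : ∀ x t, |w'' x t| ≤ κ₂) (hlamw : 0 ≤ lamw) (hΛw : 0 ≤ Λw)
    (hwlo : ∀ u (a b : ℝ), w u a + w' u a * (b - a) - lamw / 2 * (b - a) ^ 2 ≤ w u b)
    (hwup : ∀ x (a b : ℝ), w x b ≤ w x a + w' x a * (b - a) + Λw / 2 * (b - a) ^ 2) (hm : 2 * lamw ≤ m) (C : Finset V)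
    (ψ₀ : EuclideanSpace ℝ ι)
    {d : ι → ι → ℕ} (htri : ∀ i j k, d i k ≤ d i j + d j k) (hd : ∀ i, d i i = 0) {ρY ρS : ℕ}
    (hY : ∀ x ∈ C.biUnion cell, ∀ y ∈ C.biUnion cell, d x y ≤ ρY) {S : Matrix ι ι ℝ} {γ' : ℝ} (hS : S.PosDef)
    (hSγ : (γ' • (1 : Matrix ι ι ℝ) - S).PosSemidef) (hγ' : 0 < γ') (hSr : HasFiniteRange d ρS S) (hsmall : 2 * lamw * γ' < 1)
    (N : ℕ) {x y : ι} (hxy : N * (ρS + ρY) + ρS < d x y) :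
    |(S⁻¹ + (Matrix.of fun x y : ι =>
      ((((∫ ω : EuclideanSpace ℝ ι, exp (-(∑ p ∈ C, ∑ x ∈ cell p, w x (ω x + ψ₀ x))) ∂(multivariateGaussian 0 M⁻¹))⁻¹ •
          (∫ ω : EuclideanSpace ℝ ι, exp (-(∑ p ∈ C, ∑ x ∈ cell p, w x (ω x + ψ₀ x))) •
            ((∑ p ∈ C, ∑ x ∈ cell p, (w'' x (ω x + ψ₀ x)) • ((EuclideanSpace.proj x : EuclideanSpace ℝ ι →L[ℝ] ℝ).smulRight
                (EuclideanSpace.proj x : EuclideanSpace ℝ ι →L[ℝ] ℝ))) -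
              (∑ p ∈ C, ∑ x ∈ cell p, (w' x (ω x + ψ₀ x)) • (EuclideanSpace.proj x : EuclideanSpace ℝ ι →L[ℝ] ℝ)).smulRight
                (∑ p ∈ C, ∑ x ∈ cell p, (w' x (ω x + ψ₀ x)) • (EuclideanSpace.proj x : EuclideanSpace ℝ ι →L[ℝ] ℝ)))
            ∂(multivariateGaussian 0 M⁻¹)) +
        (((∫ ω : EuclideanSpace ℝ ι, exp (-(∑ p ∈ C, ∑ x ∈ cell p, w x (ω x + ψ₀ x))) ∂(multivariateGaussian 0 M⁻¹)) ^ 2)⁻¹ •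
          ∫ ω : EuclideanSpace ℝ ι, exp (-(∑ p ∈ C, ∑ x ∈ cell p, w x (ω x + ψ₀ x))) •
            (∑ p ∈ C, ∑ x ∈ cell p, (w' x (ω x + ψ₀ x)) • (EuclideanSpace.proj x : EuclideanSpace ℝ ι →L[ℝ] ℝ))
            ∂(multivariateGaussian 0 M⁻¹)).smulRight
          (∫ ω : EuclideanSpace ℝ ι, exp (-(∑ p ∈ C, ∑ x ∈ cell p, w x (ω x + ψ₀ x))) •
            (∑ p ∈ C, ∑ x ∈ cell p, (w' x (ω x + ψ₀ x)) • (EuclideanSpace.proj x : EuclideanSpace ℝ ι →L[ℝ] ℝ))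
            ∂(multivariateGaussian 0 M⁻¹)))
          (EuclideanSpace.single x (1 : ℝ)) (EuclideanSpace.single y (1 : ℝ)) +
        ((∫ ω : EuclideanSpace ℝ ι, exp (-(∑ p ∈ C, ∑ x ∈ cell p, w x (ω x + ψ₀ x))) ∂(multivariateGaussian 0 M⁻¹))⁻¹ •
          (∫ ω : EuclideanSpace ℝ ι, exp (-(∑ p ∈ C, ∑ x ∈ cell p, w x (ω x + ψ₀ x))) •
            ((∑ p ∈ C, ∑ x ∈ cell p, (w'' x (ω x + ψ₀ x)) • ((EuclideanSpace.proj x : EuclideanSpace ℝ ι →L[ℝ] ℝ).smulRight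
                (EuclideanSpace.proj x : EuclideanSpace ℝ ι →L[ℝ] ℝ))) -
              (∑ p ∈ C, ∑ x ∈ cell p, (w' x (ω x + ψ₀ x)) • (EuclideanSpace.proj x : EuclideanSpace ℝ ι →L[ℝ] ℝ)).smulRight
                (∑ p ∈ C, ∑ x ∈ cell p, (w' x (ω x + ψ₀ x)) • (EuclideanSpace.proj x : EuclideanSpace ℝ ι →L[ℝ] ℝ)))
            ∂(multivariateGaussian 0 M⁻¹)) +
        (((∫ ω : EuclideanSpace ℝ ι, exp (-(∑ p ∈ C, ∑ x ∈ cell p, w x (ω x + ψ₀ x))) ∂(multivariateGaussian 0 M⁻¹)) ^ 2)⁻¹ •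
          ∫ ω : EuclideanSpace ℝ ι, exp (-(∑ p ∈ C, ∑ x ∈ cell p, w x (ω x + ψ₀ x))) •
            (∑ p ∈ C, ∑ x ∈ cell p, (w' x (ω x + ψ₀ x)) • (EuclideanSpace.proj x : EuclideanSpace ℝ ι →L[ℝ] ℝ))
            ∂(multivariateGaussian 0 M⁻¹)).smulRight
          (∫ ω : EuclideanSpace ℝ ι, exp (-(∑ p ∈ C, ∑ x ∈ cell p, w x (ω x + ψ₀ x))) •
            (∑ p ∈ C, ∑ x ∈ cell p, (w' x (ω x + ψ₀ x)) • (EuclideanSpace.proj x : EuclideanSpace ℝ ι →L[ℝ] ℝ))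
            ∂(multivariateGaussian 0 M⁻¹)))
          (EuclideanSpace.single y (1 : ℝ)) (EuclideanSpace.single x (1 : ℝ))) / 2)))⁻¹ x y| ≤ (γ' * (Λw + 4 * lamw)) ^ (N + 1) * (γ' / (1 - 2 * lamw * γ')) := by
  obtain ⟨-, hlo, -⟩ := nextHessianMatrix_letters hM hfl hΓop hdisj hw' hw'' hw'm hw''m hκ₀ hκ₁ hτ hδ hθ0 hθ1 hκθ hκθ₆ hstab hquad hw'b hw''b hlamw hΛw hwlo hwup hm C ψ₀
  have hKr := nextHessianMatrix_hasFiniteRange hM.inv.posSemidef hΓop hdisj hw' hw'm hw''m hκ₀ hκ₁ hτ hδ hθ1 hκθ hstab hw'b hw''b C ψ₀ hY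
  exact dressed_covariance_decay htri hd hS hSγ hγ' hlo hsmall (by positivity) (nextHessianMatrix_opBound hM hfl hΓop hdisj hw' hw'' hw'm hw''m hκ₀ hκ₁ hτ hδ hθ0 hθ1 hκθ hκθ₆ hstab hquad hw'b hw''b hlamw hΛw hwlo hwup hm C ψ₀) hSr hKr N hxy

end Road

/-! ## §4. Toy -/

/-- Toy (§1): `K = 0` with `k = c = 0` has operator letter `0`. -/
example (v : ι → ℝ) : ‖(WithLp.toLp 2 ((0 : Matrix ι ι ℝ) *ᵥ v) : EuclideanSpace ℝ ι)‖ ≤ (0 + 2 * 0) * ‖(WithLp.toLp 2 v : EuclideanSpace ℝ ι)‖ :=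
  opBound_of_two_sided (by rw [zero_smul, add_zero]; exact Matrix.PosSemidef.zero) (by rw [zero_smul, sub_zero]; exact Matrix.PosSemidef.zero)
    le_rfl (by norm_num) v

end Summit.QuantumFields.BalabanUV.T4Continuum.NE7b.SupRoadDressedCovarianceDecay
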